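import Literature.NumberTheory.Weil1964.ArchMetaplecticUnitaryDetCharacter
import Literature.RepresentationTheory.Paul1998.MetaplecticDetCoverLifting
import HarnessLib

/-!
# Paul 1998 (1.2.1)–(1.2.2) at EVERY real rank: the metaplectic cocycle on `ι_V(U(p,q))` and `ι_W(U(r,s))` is the
# coboundary of a square root of `det^{r−s}`, `det^{p−q}` — cocycle sections, exact commutation, and the det-cover
# lifting of `Mp₂.coverDatum` (kernel; 0 named facts; no Fock vacuum character, no `KAK`)

Topic `RepresentationTheory/Paul1998`; namespace `Literature.RepresentationTheory.Paul1998.MetaplecticSplitting`.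
Sequel of `DetCoverCocycleRankOne` (t-b08-2: `[Subsingleton Q]`, from the record `FockVacuumCharacter`) and
`MetaplecticDetCoverLifting` (b19: the junction `cocycleSectionV/W` with B08-1's `CocycleSection`, and the record
`DetCoverLifting` at real rank `≤ 1`).  INPUT: the genuine character `θ(x) = C(x) · det d(G)` of
`Weil1964.ArchMetaplecticUnitaryDetCharacter` on Folland's metaplectic elements over `toSp(U(α, β))`
(`detHalf_sq : θ² = det G`, `detHalf_mul : θ(xy) = θ(x)θ(y)`, `detHalf_negOne_mul`), valid for ALL `α, β`.

* §1 `exists_section_toSp`: over the standard embedding `toSp : U(α,β) → Sp(W)` there are a metaplectic section `τ` and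
  units `θ(G)` with `θ(G)² = det G` whose defect IS the cocycle of `τ`:
  `τ(G₁)τ(G₂) = (if θ₁θ₂ = θ₁₂ then 1 else −1) · τ(G₁G₂)` — i.e. the inverse image of `toSp(U(α,β))` in `Mp₂(W)` is the
  `det^{1/2}`-cover of `U(α,β)` (Paul's (1.2.1)–(1.2.2) for the pair `(U(α,β), U(1))`);
* §2 `commute_of_isMetaplectic`: metaplectic lifts of COMMUTING elements of `toSp(U(α,β))` commute EXACTLY
  ([Adams2007, Rem. 5.1] «`G̃` commutes with `G̃′`»: `θ(xy) = θ(x)θ(y) = θ(yx)` separates `yx` from `−xy`);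
* §3 for the dual pair `(U(P,Q), U(R,S))` in `Sp(𝕎)` (`ι𝕎 = toSp ∘ toBig`, `toBig(g,h) = g ⊗ h` reindexed,
  `det(g ⊗ 1) = det(g)^{|R|+|S|}`): the cocycle data of `DetCoverCocycleRankOne.exists_cocycleSectionV/W` WITHOUT
  `[Subsingleton Q]`/`[Subsingleton S]` and WITHOUT the vacuum-character hypothesis (`σ_V = θ · det^{−|S|}`,
  `σ_W = θ · det^{−|Q|}`), the B08-1 cocycle sections `cocycleSectionV_general`, `cocycleSectionW_general` of
  `Mp₂.coverDatum P Q R S h1 h2`, the commutation `hc`, and **`exists_isDetCoverLifting_general`**: a homomorphism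
  `L : Ũ(P,Q)_{det} × Ũ(R,S)_{det} →* Mp₂(𝕎)` satisfying the record's `IsDetCoverLifting` — (1.2.1)–(1.2.2) minus only the
  `Continuous L` clause — at every `(P, Q, R, S)`; `_holds` versions discharge R1/R2 by `folland1989_Thm_4_37_ab/c_holds`.

NOT here: `Continuous L` (the record `DetCoverLifting` itself at general rank needs the SOT-continuity of `τ`, `σ` at `1`).

## References

* [Paul1998] A. Paul, *Howe correspondence for real unitary groups*, J. Funct. Anal. 159 (1998), §1.2 (1.2.1)–(1.2.2).
* [Adams2007] J. Adams, *The theta correspondence over ℝ*, in: Harmonic Analysis, Group Representations, Automorphic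
  Forms and Invariant Theory, World Scientific 2007, Rem. 5.1.
* [KashiwaraVergne1978] M. Kashiwara, M. Vergne, Invent. Math. 44 (1978), §3.
-/

set_option autoImplicit false

noncomputable section

open Matrix Complex
open scoped ComplexConjugate

namespace Literature.RepresentationTheory.Paul1998

namespace MetaplecticSplitting

open Literature.RepresentationTheory.KonnoKonno2007 Literature.RepresentationTheory.KonnoKonno2007.RealDualPair
open Literature.NumberTheory.Weil1964 Literature.NumberTheory.Weil1964.MpS Literature.NumberTheory.Weil1964.UnitaryBall
open Literature.NumberTheory.Automorphic Literature.NumberTheory.Automorphic.UnitaryGroup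
open Literature.Analysis.SegalBargmann

/-! ## 1. The `det^{1/2}`-cover over `toSp(U(α, β))` -/

section Generic

variable {α β : Type*} [Fintype α] [DecidableEq α] [Fintype β] [DecidableEq β]

/-- `θ ≠ 0` for a metaplectic element over `toSp G`. [cite: Paul1998, §1.2 (1.2.2)] -/
theorem detHalf_ne_zero {x : MpS (α ⊕ β)} (hx : IsMetaplectic x) {G : UForm α β}
    (hxG : proj x = UForm.toSp α β G) : detHalf x G ≠ 0 := fun h => by
  have h1 := norm_detHalf hx hxG
  rw [h, norm_zero] at h1
  exact zero_ne_one h1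

/-- **The inverse image of `toSp(U(α,β))` in Folland's metaplectic cover is the `det^{1/2}`-cover of `U(α,β)`**, in the
shape the tree's junctions consume: a metaplectic section `τ` over `toSp` and units `θ(G)` with `θ(G)² = det G` whose
defect IS the cocycle of `τ`. [cite: Paul1998, §1.2 (1.2.1)–(1.2.2) p. 389 L11–29; KashiwaraVergne1978, §3] -/
theorem exists_section_toSp (hR1 : Folland1989_Thm_4_37_ab (α ⊕ β)) (hR2 : Folland1989_Thm_4_37_c (α ⊕ β)) :
    ∃ (τ : UForm α β → MpS (α ⊕ β)) (θ : UForm α β → ℂˣ),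
      (∀ G, proj (τ G) = UForm.toSp α β G) ∧ (∀ G, IsMetaplectic (τ G)) ∧
      (∀ G, ((θ G : ℂˣ) : ℂ) ^ 2 = (mat G).det) ∧
      ∀ G₁ G₂, τ G₁ * τ G₂ = (if θ G₁ * θ G₂ = θ (G₁ * G₂) then 1 else negOne) * τ (G₁ * G₂) := by
  classical
  choose τ hτ using fun G : UForm α β => hR1 (UForm.toSp α β G)
  have hne : ∀ G, detHalf (τ G) G ≠ 0 := fun G => detHalf_ne_zero (hτ G).2 (hτ G).1
  refine ⟨τ, fun G => Units.mk0 (detHalf (τ G) G) (hne G), fun G => (hτ G).1, fun G => (hτ G).2,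
    fun G => by rw [Units.val_mk0]; exact detHalf_sq (hτ G).2 (hτ G).1, fun G₁ G₂ => ?_⟩
  have hmet₁₂ : IsMetaplectic (τ (G₁ * G₂)) := (hτ _).2
  have hmet : IsMetaplectic (τ G₁ * τ G₂) := hR2 _ _ (hτ G₁).2 (hτ G₂).2
  have hproj : proj (τ (G₁ * G₂)) = proj (τ G₁ * τ G₂) := by
    rw [map_mul, (hτ _).1, (hτ _).1, (hτ _).1, map_mul]
  have hmul := detHalf_mul (hτ G₁).2 (hτ G₂).2 (hτ G₁).1 (hτ G₂).1
  have hunits : (Units.mk0 (detHalf (τ G₁) G₁) (hne G₁) * Units.mk0 (detHalf (τ G₂) G₂) (hne G₂) =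
      Units.mk0 (detHalf (τ (G₁ * G₂)) (G₁ * G₂)) (hne _)) ↔
        detHalf (τ G₁) G₁ * detHalf (τ G₂) G₂ = detHalf (τ (G₁ * G₂)) (G₁ * G₂) := by
    rw [← Units.val_inj, Units.val_mul, Units.val_mk0, Units.val_mk0, Units.val_mk0]
  rcases hmet₁₂.eq_or_eq_negOne_mul hmet hproj with h | h
  · have hθ : detHalf (τ G₁) G₁ * detHalf (τ G₂) G₂ = detHalf (τ (G₁ * G₂)) (G₁ * G₂) := by rw [← hmul, h]
    rw [if_pos (hunits.2 hθ), one_mul, h]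
  · have hθ : detHalf (τ G₁) G₁ * detHalf (τ G₂) G₂ ≠ detHalf (τ (G₁ * G₂)) (G₁ * G₂) := by
      rw [← hmul, h, detHalf_negOne_mul]
      intro h0
      have h2 : (2 : ℂ) * detHalf (τ (G₁ * G₂)) (G₁ * G₂) = 0 := by linear_combination -h0
      exact hne _ ((mul_eq_zero.1 h2).resolve_left two_ne_zero)
    rw [if_neg (fun hu => hθ (hunits.1 hu)), h]

/-- **Metaplectic lifts of commuting elements of `toSp(U(α,β))` commute EXACTLY** (not just up to `±1`): the
character `θ` satisfies `θ(xy) = θ(x)θ(y) = θ(yx)` and separates `yx` from `−(xy)`.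
[cite: Adams2007, Rem. 5.1; Paul1998, §1.1 p. 389 L5–6] -/
theorem commute_of_isMetaplectic (hR2 : Folland1989_Thm_4_37_c (α ⊕ β)) {x y : MpS (α ⊕ β)}
    (hx : IsMetaplectic x) (hy : IsMetaplectic y) {G₁ G₂ : UForm α β} (hxG : proj x = UForm.toSp α β G₁)
    (hyG : proj y = UForm.toSp α β G₂) (hc : Commute G₁ G₂) : Commute x y := by
  have hxy : IsMetaplectic (x * y) := hR2 _ _ hx hy
  have hyx : IsMetaplectic (y * x) := hR2 _ _ hy hx
  have hproj : proj (x * y) = proj (y * x) := by rw [map_mul, map_mul, hxG, hyG, ← map_mul, ← map_mul, hc.eq]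
  rcases hxy.eq_or_eq_negOne_mul hyx hproj with h | h
  · exact h.symm
  · exfalso
    have h1 := detHalf_mul hx hy hxG hyG          -- θ(xy)(G₁G₂) = θ(x)θ(y)
    have h2 := detHalf_mul hy hx hyG hxG          -- θ(yx)(G₂G₁) = θ(y)θ(x)
    rw [h, detHalf_negOne_mul, ← hc.eq, h1] at h2
    have h3 : (2 : ℂ) * (detHalf x G₁ * detHalf y G₂) = 0 := by linear_combination -h2
    have hxy12 : proj (x * y) = UForm.toSp α β (G₁ * G₂) := by rw [map_mul, hxG, hyG, map_mul]
    exact detHalf_ne_zero hxy hxy12 (by rw [h1]; exact (mul_eq_zero.1 h3).resolve_left two_ne_zero)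

end Generic

/-! ## 2. The dual pair `(U(P,Q), U(R,S))`: cocycle sections at every real rank -/

section DualPair

variable {P Q R S : Type*} [Fintype P] [DecidableEq P] [Fintype Q] [DecidableEq Q] [Fintype R] [DecidableEq R]
  [Fintype S] [DecidableEq S]

/-- `ι𝕎 = toSp ∘ toBig` (by construction). [cite: KonnoKonno2007, §3.1 (3.1)] -/
theorem ι𝕎_eq_toSp_toBig (g : Ginf P Q R S) :
    ι𝕎 P Q R S g = UForm.toSp ((P × R) ⊕ (Q × S)) ((P × S) ⊕ (Q × R)) (toBig P Q R S g) := rfl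

/-- `det(g ⊗ 1_W) = det(g)^{|R|+|S|}` in the block frame. [cite: Paul1998, §1.1 (1.1.1)] -/
theorem det_mat_toBig_inl (g : UForm P Q) :
    (mat (toBig P Q R S (g, 1))).det =
      ((Matrix.GeneralLinearGroup.det (g : GL (P ⊕ Q) ℂ) : ℂˣ) : ℂ) ^ (Fintype.card R + Fintype.card S) := by
  rw [mat, coe_toBig, Matrix.det_reindex_self, Matrix.det_kronecker, Matrix.GeneralLinearGroup.val_det_apply,
    Fintype.card_sum]
  simp

/-- `det(1_V ⊗ h) = det(h)^{|P|+|Q|}` in the block frame. [cite: Paul1998, §1.1 (1.1.1)] -/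
theorem det_mat_toBig_inr (h : UForm R S) :
    (mat (toBig P Q R S (1, h))).det =
      ((Matrix.GeneralLinearGroup.det (h : GL (R ⊕ S) ℂ) : ℂˣ) : ℂ) ^ (Fintype.card P + Fintype.card Q) := by
  rw [mat, coe_toBig, Matrix.det_reindex_self, Matrix.det_kronecker, Matrix.GeneralLinearGroup.val_det_apply,
    Fintype.card_sum]
  simp

/-- Integer-power bookkeeping in `ℂˣ`: if `θ² = D^{m+s}` then `(θ D^{−s})² = D^{m−s}`. [folklore] -/
private theorem units_sq_shift {θ D : ℂˣ} {m s : ℕ} (h : θ ^ 2 = D ^ (m + s)) :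
    (θ * D ^ (-(s : ℤ))) ^ 2 = D ^ ((m : ℤ) - s) := by
  rw [mul_pow, h, ← zpow_natCast D (m + s), ← zpow_natCast (D ^ (-(s : ℤ))) 2, ← _root_.zpow_mul, ← _root_.zpow_add]
  congr 1
  push_cast
  ring

/-- Transport of the `if`-condition along `σ = θ · u` with `u` multiplicative. [folklore] -/
private theorem units_if_iff (θ₁ θ₂ θ₁₂ u₁ u₂ : ℂˣ) :
    θ₁ * u₁ * (θ₂ * u₂) = θ₁₂ * (u₁ * u₂) ↔ θ₁ * θ₂ = θ₁₂ := by
  rw [mul_mul_mul_comm, mul_left_inj]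

/-- **Paul (1.2.1)–(1.2.2), `V`-side, EVERY REAL RANK** (no `[Subsingleton Q]`, no vacuum-character hypothesis): the
data of `DetCoverCocycleRankOne.exists_cocycleSectionV` — a metaplectic section `τ` over `ι_V` and a square root `σ` of
`det^{|R|−|S|}` whose defect is the cocycle of `τ`. [cite: Paul1998, §1.2 (1.2.1)–(1.2.2) p. 389 L11–29] -/
theorem exists_cocycleSectionV_general (hR1 : Folland1989_Thm_4_37_ab (DPIdx P Q R S))
    (hR2 : Folland1989_Thm_4_37_c (DPIdx P Q R S)) :
    ∃ (τ : UForm P Q → MpS (DPIdx P Q R S)) (σ : UForm P Q → ℂˣ),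
      (∀ g, proj (τ g) = ι𝕎 P Q R S (g, 1)) ∧ (∀ g, IsMetaplectic (τ g)) ∧
      (∀ g, σ g ^ 2 = Matrix.GeneralLinearGroup.det (g : GL (P ⊕ Q) ℂ) ^ ((Fintype.card R : ℤ) - Fintype.card S)) ∧
      ∀ g₁ g₂, τ g₁ * τ g₂ = (if σ g₁ * σ g₂ = σ (g₁ * g₂) then 1 else negOne) * τ (g₁ * g₂) := by
  obtain ⟨τ, θ, hpr, hmet, hsq, hmul⟩ :=
    exists_section_toSp (α := (P × R) ⊕ (Q × S)) (β := (P × S) ⊕ (Q × R)) hR1 hR2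
  have hθsq : ∀ g : UForm P Q, θ (toBig P Q R S (g, 1)) ^ 2 =
      Matrix.GeneralLinearGroup.det (g : GL (P ⊕ Q) ℂ) ^ (Fintype.card R + Fintype.card S) := fun g => by
    apply Units.ext
    rw [Units.val_pow_eq_pow_val, hsq, det_mat_toBig_inl, Units.val_pow_eq_pow_val]
  refine ⟨fun g => τ (toBig P Q R S (g, 1)),
    fun g => θ (toBig P Q R S (g, 1)) * Matrix.GeneralLinearGroup.det (g : GL (P ⊕ Q) ℂ) ^ (-(Fintype.card S : ℤ)),
    fun g => hpr _, fun g => hmet _, fun g => units_sq_shift (hθsq g), fun g₁ g₂ => ?_⟩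
  have hbig : toBig P Q R S (g₁ * g₂, 1) = toBig P Q R S (g₁, 1) * toBig P Q R S (g₂, 1) := by
    rw [← map_mul, Prod.mk_mul_mk, mul_one]
  have hdet : Matrix.GeneralLinearGroup.det ((g₁ * g₂ : UForm P Q) : GL (P ⊕ Q) ℂ) =
      Matrix.GeneralLinearGroup.det (g₁ : GL (P ⊕ Q) ℂ) * Matrix.GeneralLinearGroup.det (g₂ : GL (P ⊕ Q) ℂ) := by
    rw [Subgroup.coe_mul, map_mul]
  dsimp only
  rw [hmul]
  congr 1
  · refine if_congr ?_ rfl rfl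
    rw [hbig, hdet, mul_zpow]
    exact (units_if_iff _ _ _ _ _).symm
  · rw [hbig]

/-- **Paul (1.2.1)–(1.2.2), `W`-side, EVERY REAL RANK**: the data of `DetCoverCocycleRankOne.exists_cocycleSectionW`
without `[Subsingleton S]` and without the vacuum-character hypothesis. [cite: Paul1998, §1.2 (1.2.1) p. 389 L23] -/
theorem exists_cocycleSectionW_general (hR1 : Folland1989_Thm_4_37_ab (DPIdx P Q R S))
    (hR2 : Folland1989_Thm_4_37_c (DPIdx P Q R S)) :
    ∃ (τ : UForm R S → MpS (DPIdx P Q R S)) (σ : UForm R S → ℂˣ),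
      (∀ g, proj (τ g) = ι𝕎 P Q R S (1, g)) ∧ (∀ g, IsMetaplectic (τ g)) ∧
      (∀ g, σ g ^ 2 = Matrix.GeneralLinearGroup.det (g : GL (R ⊕ S) ℂ) ^ ((Fintype.card P : ℤ) - Fintype.card Q)) ∧
      ∀ g₁ g₂, τ g₁ * τ g₂ = (if σ g₁ * σ g₂ = σ (g₁ * g₂) then 1 else negOne) * τ (g₁ * g₂) := by
  obtain ⟨τ, θ, hpr, hmet, hsq, hmul⟩ :=
    exists_section_toSp (α := (P × R) ⊕ (Q × S)) (β := (P × S) ⊕ (Q × R)) hR1 hR2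
  have hθsq : ∀ g : UForm R S, θ (toBig P Q R S (1, g)) ^ 2 =
      Matrix.GeneralLinearGroup.det (g : GL (R ⊕ S) ℂ) ^ (Fintype.card P + Fintype.card Q) := fun g => by
    apply Units.ext
    rw [Units.val_pow_eq_pow_val, hsq, det_mat_toBig_inr, Units.val_pow_eq_pow_val]
  refine ⟨fun g => τ (toBig P Q R S (1, g)),
    fun g => θ (toBig P Q R S (1, g)) * Matrix.GeneralLinearGroup.det (g : GL (R ⊕ S) ℂ) ^ (-(Fintype.card Q : ℤ)),
    fun g => hpr _, fun g => hmet _, fun g => units_sq_shift (hθsq g), fun g₁ g₂ => ?_⟩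
  have hbig : toBig P Q R S (1, g₁ * g₂) = toBig P Q R S (1, g₁) * toBig P Q R S (1, g₂) := by
    rw [← map_mul, Prod.mk_mul_mk, one_mul]
  have hdet : Matrix.GeneralLinearGroup.det ((g₁ * g₂ : UForm R S) : GL (R ⊕ S) ℂ) =
      Matrix.GeneralLinearGroup.det (g₁ : GL (R ⊕ S) ℂ) * Matrix.GeneralLinearGroup.det (g₂ : GL (R ⊕ S) ℂ) := by
    rw [Subgroup.coe_mul, map_mul]
  dsimp only
  rw [hmul]
  congr 1
  · refine if_congr ?_ rfl rfl
    rw [hbig, hdet, mul_zpow]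
    exact (units_if_iff _ _ _ _ _).symm
  · rw [hbig]

variable [Nonempty (P ⊕ Q)] [Nonempty (R ⊕ S)]

/-- **B08-1's cocycle section on the `V`-side of `Mp₂.coverDatum P Q R S`, at every real rank.**
[cite: Paul1998, §1.2 (1.2.1) p. 389 L11–23] -/
theorem nonempty_cocycleSectionV (h1 : Folland1989_Thm_4_37_ab (DPIdx P Q R S))
    (h2 : Folland1989_Thm_4_37_c (DPIdx P Q R S)) :
    Nonempty ((Mp₂.coverDatum P Q R S h1 h2).CocycleSection ((Fintype.card R : ℤ) - Fintype.card S)) := by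
  obtain ⟨τ, σ, hpr, hmet, hσ, hmul⟩ := exists_cocycleSectionV_general (P := P) (Q := Q) (R := R) (S := S) h1 h2
  exact ⟨cocycleSectionV h1 h2 τ σ hpr hmet hσ hmul⟩

/-- **B08-1's cocycle section on the `W`-side (swapped datum), at every real rank.**
[cite: Paul1998, §1.2 (1.2.1) p. 389 L23] -/
theorem nonempty_cocycleSectionW (h1 : Folland1989_Thm_4_37_ab (DPIdx P Q R S))
    (h2 : Folland1989_Thm_4_37_c (DPIdx P Q R S)) :
    Nonempty ((Mp₂.coverDatum P Q R S h1 h2).swap.CocycleSection ((Fintype.card P : ℤ) - Fintype.card Q)) := by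
  obtain ⟨τ, σ, hpr, hmet, hσ, hmul⟩ := exists_cocycleSectionW_general (P := P) (Q := Q) (R := R) (S := S) h1 h2
  exact ⟨cocycleSectionW h1 h2 τ σ hpr hmet hσ hmul⟩

/-- **`Ũ(P,Q)` and `Ũ(R,S)` commute in `Mp₂(𝕎)` — B08-1's `hc`, EVERY REAL RANK, no vacuum character.**
[cite: Adams2007, Rem. 5.1; Paul1998, §1.1 p. 389 L5–6] -/
theorem commute_coverV_coverW_general (h1 : Folland1989_Thm_4_37_ab (DPIdx P Q R S))
    (h2 : Folland1989_Thm_4_37_c (DPIdx P Q R S)) :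
    ∀ m ∈ (Mp₂.coverDatum P Q R S h1 h2).coverV, ∀ m' ∈ (Mp₂.coverDatum P Q R S h1 h2).coverW, Commute m m' := by
  intro m hm m' hm'
  obtain ⟨g, hg⟩ := (Mp₂.mem_coverV_iff h1 h2 m).1 hm
  obtain ⟨h, hh⟩ := (Mp₂.mem_coverW_iff h1 h2 m').1 hm'
  have hc : Commute (toBig P Q R S (g, 1)) (toBig P Q R S (1, h)) := by
    rw [Commute, SemiconjBy, ← map_mul, ← map_mul, Prod.mk_mul_mk, Prod.mk_mul_mk, one_mul, mul_one, one_mul,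
      mul_one]
  have hcm : Commute (m : MpS (DPIdx P Q R S)) (m' : MpS (DPIdx P Q R S)) :=
    commute_of_isMetaplectic h2 (Mp₂.isMetaplectic_coe h1 h2 m) (Mp₂.isMetaplectic_coe h1 h2 m') hg.symm hh.symm hc
  exact Subtype.ext hcm.eq

/-- **THE DET-COVER LIFTING OF (1.2.1) FOR `Mp₂(𝕎)`, EVERY REAL RANK, topology-free content**: there is a homomorphism
`L : Ũ(P,Q)_{det^{(r−s)/2}} × Ũ(R,S)_{det^{(p−q)/2}} →* Mp₂(𝕎)` over `ι_J` whose restrictions are isomorphisms onto the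
inverse images of `ι_V(U(P,Q))`, `ι_W(U(R,S))` (the record's `IsDetCoverLifting`).
[cite: Paul1998, §1.2 (1.2.1)–(1.2.2) p. 389 L11–31] -/
theorem exists_isDetCoverLifting_general (h1 : Folland1989_Thm_4_37_ab (DPIdx P Q R S))
    (h2 : Folland1989_Thm_4_37_c (DPIdx P Q R S)) :
    ∃ L, (Mp₂.coverDatum P Q R S h1 h2).IsDetCoverLifting L := by
  exact DualPairCoverDatum.exists_isDetCoverLifting_iff.2
    ⟨nonempty_cocycleSectionV h1 h2, nonempty_cocycleSectionW h1 h2, commute_coverV_coverW_general h1 h2⟩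

/-- **HYPOTHESIS-FREE**: the det-cover lifting of `Mp₂.coverDatum P Q R S` with R1/R2 discharged by the tree's
`folland1989_Thm_4_37_ab_holds` / `_c_holds` — Paul (1.2.1)–(1.2.2) minus the `Continuous` clause, for ALL `P Q R S`.
[cite: Paul1998, §1.2 (1.2.1)–(1.2.2) p. 389 L11–31] -/
theorem exists_isDetCoverLifting_general_holds :
    ∃ L, (Mp₂.coverDatum P Q R S (folland1989_Thm_4_37_ab_holds _) (folland1989_Thm_4_37_c_holds _)).IsDetCoverLifting L :=
  exists_isDetCoverLifting_general _ _

end DualPair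

end MetaplecticSplitting

end Literature.RepresentationTheory.Paul1998
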